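import Summits.Parity.GeneralizedHardyLittlewood.Theses.LeeYangFibres
import Summits.Parity.GeneralizedHardyLittlewood.Theorems.LeeYangFibresRelativeDimOneFloatingSiegelRepulsionFree
import Summits.Parity.GeneralizedHardyLittlewood.Theorems.LeeYangFibresRelativeDimOneFloatingCalibrationFree
import Summits.Parity.GeneralizedHardyLittlewood.Theorems.LeeYangFibresRelativeDimOneFloatingCalibration
import Summits.Parity.GeneralizedHardyLittlewood.Theorems.LeeYangFibresAbsoluteUpgradeIllusory
import Summits.Parity.GeneralizedHardyLittlewood.Theorems.LeeYangFibresPrimeCellsRelativeLocator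
import Summits.Parity.GeneralizedHardyLittlewood.Theorems.LeeYangFibresHyperbolicityClipsParity
import Summits.Parity.GeneralizedHardyLittlewood.Theorems.LeeYangFibresModelCellFacts
import HarnessLib

/-!
# Line `floating-level-core` — skeleton for the crux `RelativeDimOne` (stmt-Parity-14113)
# END STATE (lead seats c5, re-verified by c6 2026-08-17): the crux IS its parity atom —
# `RelativeDimOne ↔ IncidenceBandlimitedCoreDecay (1/4)`, kernel-checked with NO literature debt; ONE registered stub, the atom P′

Seat c6 (this file's last editor) changed NO statement and NO stub: it re-checked the end state against the current tree and added
`section NodePosition` — sorry-free certificates that the one registered stub `stub_coreDecay` is DISCHARGED by each of the existing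
ITEMS upstream of this derived node (stmt-Parity-14112 `PrimeCellsRelative`; stmt-Parity-14109 ∧ stmt-Parity-14108, the route's
designed in-arrow; the shared target stmt-Parity-0819 `DimOne`; the sub-problem Statement) and is twin-prime-hard downstream.

Route `LeeYangFibres` (Parity / GeneralizedHardyLittlewood); crux decl
`Summit.Parity.GeneralizedHardyLittlewood.Theses.LeeYangFibres.RelativeDimOne` (the `Λ`-form of Green–Tao Conj. 1.4 at `d = 1`,
uniform over non-degenerate systems `‖Ψ‖_N ≤ L`, convex `K ⊆ [-N,N]`, error `ε(β_∞𝔖 + N)`). Idea card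
`Cruxes/RelativeDimOne/Ideas/floating-level-core.md`; line card `Cruxes/RelativeDimOne/Lines/floating-level-core.md`.

## History of the line (all files under `Theorems/LeeYangFibresRelativeDimOneFloating*.lean`, all sorry-free)

* lead a1: vocabulary `…FloatingDefs` p127461; stubs (B) `stub_siegelRepulsion` p128617 (modulo Matomäki–Merikoski 2023 Thm 1.3),
  (A) `stub_flatSecondMoment` p128951 (+ tool `…FloatingLinnikCharPNT` p128794), (C1) `stub_typeClassMomentsFlat` p127990,
  (C2) `stub_typeDataFlat` p127963, (C3) `stub_endgameFlat` p127896; composition `relativeDimOne_iff_core : MM → (crux ↔ P′(1/4))` p129131.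
* lead c4: `noSiegelZeros_of_uniformCharPNT` p130090 (Tao–Teräväinen Prop. 3.5 + Mertens + Chebyshev + Abel), whence debt-free NECESSITY
  `RelativeDimOne → NoSiegelZeros` and `relativeDimOne_iff_core_and_noSiegelZeros : crux ↔ P′(1/4) ∧ NoSiegelZeros` p130220.
* lead c5 (this seat): the registered stub `stub_pairCorrelation` (MM, XL literature debt) STRUCK and the Siegel step re-proved with
  no pair asymptotics: vocabulary `…FloatingSiegelDefs` p131818; stubs (M) `stub_pairSumModel` p132373, (T) `stub_pairMassTransfer`
  p132722, (P) `stub_excParsevalLower` p132830, (S) `stub_siegelSecondMoment` p132889, (E) `stub_siegelEndgame` p132843; composition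
  `…FloatingSiegelRepulsionFree`: `siegelRepulsion_free : ∀ θ > 0, P′(θ) → ¬UnboundedSiegelZeros` (Gallagher's identity backwards at the
  exceptional conductor `q` and its `w`-smooth radical `d`; non-exceptional DH-free Gallagher PNT; Parseval at the one character `χ`;
  Tao–Teräväinen), `noSiegelZeros_of_coreDecay_free`, and THE DEBT-FREE CALIBRATION `relativeDimOne_iff_core_free`.

## The one registered stub

* `stub_coreDecay : IncidenceBandlimitedCoreDecay (1/4)` — ATOM P′ (OPEN PROBLEM; kernel-checked NECESSARY `coreDecay_of_relativeDimOne`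
  and SUFFICIENT `relativeDimOne_of_coreDecay_free`; ≥ twin-prime-hard; `UnboundedSiegelZeros → ¬P′(θ)` for every `θ > 0`,
  `not_coreDecay_of_unboundedSiegelZeros`). Nothing else of the line is open: there is no literature debt and no provable stub left.

## Disproof.lean (cdisprove c1, VERDICT NO KILL) — honoured (see `DisproofCompatibility`).

References: Green–Tao, Ann. of Math. 171 (2010), Conj. 1.4 [GreenTao2010]; Gallagher, Invent. Math. 11 (1970), Thm 7 [Gallagher1970];
Gallagher, Mathematika 23 (1976) §2 [Gallagher1976]; Tao–Teräväinen, JLMS 106 (2022), Prop. 3.5 [TaoTeravainen2021].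
-/

noncomputable section

open scoped BigOperators Classical
open Literature.NumberTheory.Sieve Literature.Barriers.Parity
open Literature.NumberTheory.LFunctions (NoSiegelZeros)
open Summit.Parity.GeneralizedHardyLittlewood.Theses.LeeYangFibres (RelativeDimOne)
open Summit.Parity.GeneralizedHardyLittlewood.Cruxes.RelativeDimOne.GallagherBackwards (UniformCharPNT)
open Summit.Parity.GeneralizedHardyLittlewood.Cruxes.RelativeDimOne.GallagherBackwardsSplit
open Summit.Parity.GeneralizedHardyLittlewood.Cruxes.RelativeDimOne.TypeSplit

namespace Summit.Parity.GeneralizedHardyLittlewood.Cruxes.RelativeDimOne.FloatingLevelCore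

/-! ## The registered stub -/

/-- **`stub_coreDecay` — ATOM P′ (OPEN)**: the incidence-bandlimited core with Hardy–Littlewood decay at level `N^{1/4}`
(landed vocabulary `TypeSplit.IncidenceBandlimitedCoreDecay`). NECESSARY (`coreDecay_of_relativeDimOne`, every `θ > 0`) and
SUFFICIENT (`relativeDimOne_of_coreDecay_free`) for the crux, with no literature debt either way. The one residual of
stmt-Parity-14113; not for stub-workers. [cite: GreenTao2010, Conj. 1.4] -/
theorem stub_coreDecay : IncidenceBandlimitedCoreDecay (1 / 4) := by
  sorry

/-! ## The composition (REAL proof; `RelativeDimOne_of` is the file's only crux-concluding theorem) -/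

/-- **THE CRUX FROM THE ONE REGISTERED STUB, BY NAME** (concludes
`Summit.Parity.GeneralizedHardyLittlewood.Theses.LeeYangFibres.RelativeDimOne`; closed modulo the `sorry` of `stub_coreDecay`;
everything else — A, C1, C2, C3, M, T, P, S, E and both compositions — is landed and enters by name through
`relativeDimOne_of_coreDecay_free`). -/
theorem RelativeDimOne_of : RelativeDimOne :=
  relativeDimOne_of_coreDecay_free (θ := 1 / 4) (by norm_num) (by norm_num) stub_coreDecay

/-! ## Certificates (all LANDED, sorry-free; restated here as `example`s so the skeleton shows the end state) -/

section Certificates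

/-- The calibration, debt-free. -/
example : RelativeDimOne ↔ IncidenceBandlimitedCoreDecay (1 / 4) := relativeDimOne_iff_core_free

/-- … at every level. -/
example {θ : ℝ} (hθ0 : 0 < θ) (hθ1 : θ < 1) : RelativeDimOne ↔ IncidenceBandlimitedCoreDecay θ :=
  relativeDimOne_iff_core_free_at hθ0 hθ1

/-- The atom excludes Siegel zeros and proves rh.S34, debt-free. -/
example {θ : ℝ} (hθ0 : 0 < θ) : IncidenceBandlimitedCoreDecay θ → ¬ UnboundedSiegelZeros := siegelRepulsion_free θ hθ0
example {θ : ℝ} (hθ0 : 0 < θ) (hP : IncidenceBandlimitedCoreDecay θ) : NoSiegelZeros := noSiegelZeros_of_coreDecay_free hθ0 hP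

/-- The atom carries the `L`-content. -/
example {θ₁ : ℝ} (hθ₁ : θ₁ ≤ 1) (hP : IncidenceBandlimitedCoreDecay (1 / 4)) : LowClassSecondMoment θ₁ :=
  lowClassSecondMoment_of_coreDecay_free hθ₁ hP
example (hP : IncidenceBandlimitedCoreDecay (1 / 4)) : UniformCharPNT := uniformCharPNT_of_coreDecay_free hP

/-- Hardness of P′ for every line feeding it. -/
example (hU : UnboundedSiegelZeros) {θ : ℝ} (hθ0 : 0 < θ) : ¬ IncidenceBandlimitedCoreDecay θ :=
  not_coreDecay_of_unboundedSiegelZeros hU hθ0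

/-- The two earlier calibrations are recovered (MM-conditional p129131; rh.S34-conjunct p130220). -/
example (hMM : MatomakiMerikoski2023_pairCorrelation) : RelativeDimOne ↔ IncidenceBandlimitedCoreDecay (1 / 4) :=
  relativeDimOne_iff_core hMM
example : RelativeDimOne ↔ (IncidenceBandlimitedCoreDecay (1 / 4) ∧ NoSiegelZeros) := relativeDimOne_iff_core_and_noSiegelZeros

end Certificates

/-! ## §NodePosition (seat c6) — the one registered stub against the EXISTING items around this derived node

`RelativeDimOne` is the route's d = 1 OUTPUT node ("derived, not to be attacked directly", route text). Every arrow below is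
a composition BY NAME of theorems already in the tree; nothing is assumed. Reading: the stub `stub_coreDecay` (= P′) is
discharged the moment ANY of the items stmt-Parity-14112, (14109 ∧ 14108), 0819 closes, and cannot be discharged short of
the twin prime conjecture in Hardy–Littlewood strength. -/

section NodePosition
open Summit.Parity.GeneralizedHardyLittlewood.Theses.LeeYangFibres
  (PrimeCellsRelative CellParityLaw FibreHyperbolicity DimOne)
open Summit.Parity.GeneralizedHardyLittlewood.Theorems.LeeYangFibresCells (cellsToRelativeDimOne_proof)
open Summit.Parity.GeneralizedHardyLittlewood.Theorems.LeeYangFibresRelativeDimOne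
  (relativeDimOne_of_dimOne twinPrimeConjecture_of_relativeDimOne)
open Summit.Parity.GeneralizedHardyLittlewood.Cruxes.PrimeCellsRelative.Sketch
  (primeCellsRelative_iff_relativeDimOne primeCellsRelative_of_generalizedHardyLittlewood)

/-- Item stmt-Parity-14112 (`PrimeCellsRelative`, open node, ↔ crux: `primeCellsRelative_iff_relativeDimOne`) discharges the stub
(via the PROVED support stmt-Parity-14115 `cellsToRelativeDimOne_proof` and the necessity `coreDecay_of_relativeDimOne`). -/
example : PrimeCellsRelative → IncidenceBandlimitedCoreDecay (1 / 4) := fun h =>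
  coreDecay_of_relativeDimOne (by norm_num) (cellsToRelativeDimOne_proof h)

/-- … and conversely the stub closes item stmt-Parity-14112: the two open rank-9 nodes and the atom are ONE statement. -/
example : IncidenceBandlimitedCoreDecay (1 / 4) ↔ PrimeCellsRelative :=
  relativeDimOne_iff_core_free.symm.trans primeCellsRelative_iff_relativeDimOne.symm

/-- The route's DESIGNED in-arrow: the mechanism cruxes stmt-Parity-14109 (`CellParityLaw`) and stmt-Parity-14108
(`FibreHyperbolicity`) discharge the stub through the PROVED supports `HyperbolicityClipsParity_proof` (stmt-Parity-14114),
`modelCellFacts_proof` (stmt-Parity-14111) and `cellsToRelativeDimOne_proof` (stmt-Parity-14115). -/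
example : CellParityLaw → FibreHyperbolicity → IncidenceBandlimitedCoreDecay (1 / 4) := fun hL hH =>
  coreDecay_of_relativeDimOne (by norm_num) (cellsToRelativeDimOne_proof
    (Summit.Parity.GeneralizedHardyLittlewood.Theorems.HyperbolicityClipsParity_proof hL hH
      Summit.Parity.GeneralizedHardyLittlewood.Theorems.modelCellFacts_proof))

/-- The shared d = 1 target stmt-Parity-0819 (`DimOne`, Green–Tao Conj. 1.2 at d = 1) discharges the stub. -/
example : DimOne → IncidenceBandlimitedCoreDecay (1 / 4) := fun h =>
  coreDecay_of_relativeDimOne (by norm_num) (relativeDimOne_of_dimOne h)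

/-- The sub-problem Statement itself discharges the stub (the node is NECESSARY: true whenever the summit conjunct is). -/
example : _root_.GeneralizedHardyLittlewood → IncidenceBandlimitedCoreDecay (1 / 4) := fun h =>
  coreDecay_of_relativeDimOne (by norm_num)
    (cellsToRelativeDimOne_proof (primeCellsRelative_of_generalizedHardyLittlewood h))

/-- Downstream: the stub implies the twin prime conjecture (hardness; no stub set short of it can close the line). -/
example : IncidenceBandlimitedCoreDecay (1 / 4) → TwinPrimeConjecture := fun h =>
  twinPrimeConjecture_of_relativeDimOne (relativeDimOne_iff_core_free.mpr h)

end NodePosition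

/-! ## §Disproof — the landed Negative lemmas of this crux, checked against the statements of the line

Every deleted hypothesis of the disprover's load-bearing witnesses is KEPT throughout the line (`CoreApprox`: `affLinSize Ψ N ≤ L`,
`K ⊆ realBox 1 N`, `Convex ℝ K`, `IsNondegenerateSystem Ψ`; every `N₀` after `L` and `ε`; the `+ εN` slack kept); the c5 stubs are
statements about primes in progressions / pair sums on `[-(N−h), N−h] ⊆ [-N, N]`, `h ≠ 0`, `‖(n, n+h)‖_N ≤ 3` — instances of
`CoreApprox` verbatim; no statement of the line is an instance of a refuted strengthening. -/

section DisproofCompatibility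
open Summit.Parity.GeneralizedHardyLittlewood.Theorems.RelativeDimOne.Negative

example : ¬ RelativeDimOneWithoutSize := relativeDimOne_false_without_size
example : ¬ RelativeDimOneWithoutBox := relativeDimOne_false_without_box
example : ¬ RelativeDimOneWithoutConvex := relativeDimOne_false_without_convex
example : ¬ RelativeDimOneWithoutNondegenerate := relativeDimOne_false_without_nondegenerate
example : ¬ RelativeDimOneWithoutNonproportional := relativeDimOne_false_without_nonproportional
example : ¬ PurelyRelativeDimOne := not_purelyRelativeDimOne
example : ¬ RelativeDimOneLogSlack := not_relativeDimOneLogSlack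
example : ¬ RelativeDimOneUniformInSize := not_relativeDimOneUniformInSize

end DisproofCompatibility

end Summit.Parity.GeneralizedHardyLittlewood.Cruxes.RelativeDimOne.FloatingLevelCore

end
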